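import Literature.Geometry.Lorentzian.GeodesicMaximalFlow
import HarnessLib

/-!
# Continuation of geodesic lifts along an injective map

A generic continuation principle for lifting curves to geodesics, at the level of a `C¹`
covariant derivative `cov` on a Hausdorff manifold `M` without boundary (the setting of
`Literature.Geometry.Lorentzian.GeodesicMaximal`).  Let `χ : M → P` be an injective map into a
type `P`, `c : dom → P` a curve on an order-connected parameter set, and `γ` a MAXIMAL geodesic of
`cov` on `dom' ∋ 0`, `dom' ⊆ dom`, lifting `c` along `χ` (`χ ∘ γ = c` on `dom'`).  Suppose that
`c` has LOCAL geodesic lifts through every point of `χ(M)` it visits: for every `b ∈ dom` with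
`c b ∈ χ(M)` there is a geodesic `β` on an open interval `D ∋ 0` with `χ ∘ β = c(· + b)` on `D`.

* `IsMaximalGeodesicOn.mem_of_forall_exists_lift` — then the maximal lift reaches as far forward
  as `c` stays inside `χ(M)`: if `t₁ ∈ dom`, `t₁ ≥ 0` and `c([0, t₁]) ⊆ χ(M)`, then `t₁ ∈ dom'`.

Proof (the supremum argument of O'Neill 1983, Ch. 3, Prop. 24 / Ch. 5, Lemma 8): otherwise
`b = sup dom' ∈ (0, t₁]`, `c b ∈ χ(M)`, and a local lift `β` at `b` agrees with `γ(· + b)` just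
below `0` (injectivity of `χ`); the translate of `γ` by `b − δ` is the maximal geodesic with the
initial data of the translate of `β` by `−δ` (`IsMaximalGeodesicOn.comp_add`, uniqueness
`exists_isMaximalGeodesicOn`), whose domain contains `δ` — so `b ∈ dom'`, a contradiction.
Typical use: `χ` an injective local isometry, `c` a geodesic of the target, local lifts from the
local-isometry property (O'Neill 1983, Ch. 3, pp. 90–91).

Everything is proved; no definitions and no named facts are introduced.

## References

* B. O'Neill, *Semi-Riemannian geometry with applications to relativity*, Academic Press 1983,
  Ch. 3, Prop. 24 (p. 68) and pp. 90–91.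
-/

noncomputable section

open Bundle Set Function Filter
open scoped Manifold ContDiff Topology

namespace Literature.Geometry.Lorentzian

variable {E : Type*} [NormedAddCommGroup E] [NormedSpace ℝ E] {H : Type*} [TopologicalSpace H]
  {I : ModelWithCorners ℝ E H} {M : Type*} [TopologicalSpace M] [ChartedSpace H M]
  [IsManifold I ∞ M] [FiniteDimensional ℝ E]
  {cov : CovariantDerivative I E (TangentSpace I : M → Type _)}
  [CompleteSpace E] [T2Space M] [BoundarylessManifold I M]
  [CovariantDerivative.ContMDiffCovariantDerivative cov 1]
  {P : Type*}

/-- **Continuation of geodesic lifts along an injective map.**  Let `χ : M → P` be injective,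
`c` a curve on the order-connected parameter set `dom`, and `γ` a maximal geodesic of the `C¹`
connection `cov` (Hausdorff manifold without boundary) on `dom' ∋ 0`, `dom' ⊆ dom`, with
`χ ∘ γ = c` on `dom'`.  If for every `b ∈ dom` with `c b ∈ range χ` there is a geodesic `β` on an
open interval `D ∋ 0` with `χ (β u) = c (u + b)` for `u ∈ D`, then for every `t₁ ∈ dom`,
`t₁ ≥ 0`, with `c([0, t₁]) ⊆ range χ` we have `t₁ ∈ dom'`.  Supremum argument: at
`b = sup dom' ≤ t₁` a local lift agrees with `γ(· + b)` just below `0` by injectivity, and the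
translate of `γ` by `b − δ` is THE maximal geodesic with the data of the translate of the local
lift by `−δ` (O'Neill 1983, Ch. 3, Prop. 24), whose domain reaches `δ`, forcing `b ∈ dom'`.
[cite: ONeill1983, Ch. 3, Prop. 24] -/
theorem IsMaximalGeodesicOn.mem_of_forall_exists_lift {χ : M → P} (hinj : Injective χ)
    {c : ℝ → P} {dom : Set ℝ} (hdom : dom.OrdConnected)
    {γ : ℝ → M} {dom' : Set ℝ} (hmax : IsMaximalGeodesicOn cov γ dom') (h0 : (0 : ℝ) ∈ dom')
    (hsub : dom' ⊆ dom) (hagree : ∀ t ∈ dom', χ (γ t) = c t)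
    (hlift : ∀ b ∈ dom, c b ∈ range χ → ∃ (β : ℝ → M) (D : Set ℝ), IsOpen D ∧ D.OrdConnected ∧
      (0 : ℝ) ∈ D ∧ IsGeodesicOn cov β D ∧ ∀ u ∈ D, χ (β u) = c (u + b))
    {t₁ : ℝ} (ht₁ : t₁ ∈ dom) (ht₁0 : 0 ≤ t₁) (hrange : ∀ t ∈ Icc 0 t₁, c t ∈ range χ) :
    t₁ ∈ dom' := by
  by_contra hnot
  have hoc' : dom'.OrdConnected := hmax.2.1
  -- `dom'` lies below `t₁`; its supremum `b` is positive, at most `t₁`, and not in `dom'`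
  have hlt : ∀ t ∈ dom', t < t₁ := fun t ht ↦
    lt_of_not_ge fun hle ↦ hnot (hoc'.out h0 ht ⟨ht₁0, hle⟩)
  have hne : dom'.Nonempty := ⟨0, h0⟩
  have hbdd : BddAbove dom' := ⟨t₁, fun t ht ↦ (hlt t ht).le⟩
  set b := sSup dom' with hb_def
  have hbt₁ : b ≤ t₁ := csSup_le hne fun t ht ↦ (hlt t ht).le
  have hIco : Ico 0 b ⊆ dom' := fun t ht ↦ by
    obtain ⟨t', ht', htt'⟩ := exists_lt_of_lt_csSup hne ht.2
    exact hoc'.out h0 ht' ⟨ht.1, htt'.le⟩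
  have hbnot : b ∉ dom' := fun hbmem ↦ by
    obtain ⟨ε, hε, hball⟩ := Metric.isOpen_iff.1 hmax.isOpen b hbmem
    have hmem : b + ε / 2 ∈ dom' := hball (by
      rw [Metric.mem_ball, Real.dist_eq, add_sub_cancel_left, abs_of_pos (half_pos hε)]
      exact half_lt_self hε)
    have := le_csSup hbdd hmem
    linarith
  obtain ⟨ε₀, hε₀, hball₀⟩ := Metric.isOpen_iff.1 hmax.isOpen 0 h0
  have hb0 : 0 < b := by
    have hmem : ε₀ / 2 ∈ dom' := hball₀ (by
      rw [Metric.mem_ball, Real.dist_eq, sub_zero, abs_of_pos (half_pos hε₀)]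
      exact half_lt_self hε₀)
    have := le_csSup hbdd hmem
    linarith [half_pos hε₀]
  have hb01 : b ∈ Icc 0 t₁ := ⟨hb0.le, hbt₁⟩
  have hbdom : b ∈ dom := hdom.out (hsub h0) ht₁ hb01
  -- a local lift at `b`; it agrees with `γ(· + b)` wherever both make sense
  obtain ⟨β, D, hDo, hDc, h0D, hβ, hβc⟩ := hlift b hbdom (hrange b hb01)
  have hβγ : ∀ u ∈ D, u + b ∈ dom' → β u = γ (u + b) := fun u hu hu' ↦
    hinj (by rw [hβc u hu, hagree _ hu'])
  -- a parameter `δ > 0` with `-δ ∈ D` and `b - δ ∈ dom'`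
  obtain ⟨ε, hε, hballD⟩ := Metric.isOpen_iff.1 hDo 0 h0D
  set δ : ℝ := min (ε / 2) (b / 2) with hδ_def
  have hδ0 : 0 < δ := lt_min (half_pos hε) (half_pos hb0)
  have hδε : δ < ε := (min_le_left _ _).trans_lt (half_lt_self hε)
  have hδb : δ < b := (min_le_right _ _).trans_lt (half_lt_self hb0)
  have hδD : -δ ∈ D := hballD (by
    rw [Metric.mem_ball, dist_zero_right, norm_neg, Real.norm_eq_abs, abs_of_pos hδ0]
    exact hδε)
  have hbδ : b - δ ∈ dom' := hIco ⟨by linarith, by linarith⟩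
  -- the translates `u ↦ β (u - δ)` (a geodesic) and `u ↦ γ (u + (b - δ))` (maximal) near `0`
  have h1geo : IsGeodesicOn cov (fun u ↦ β (u - δ)) ((fun u ↦ u - δ) ⁻¹' D) := hβ.comp_sub_const δ
  have h1open : IsOpen ((fun u : ℝ ↦ u - δ) ⁻¹' D) := hDo.preimage (continuous_id.sub continuous_const)
  have h1oc : ((fun u : ℝ ↦ u - δ) ⁻¹' D).OrdConnected :=
    ⟨fun a₁ ha₁ a₂ ha₂ u hu ↦ hDc.out ha₁ ha₂ ⟨by linarith [hu.1], by linarith [hu.2]⟩⟩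
  have h01 : (0 : ℝ) ∈ (fun u : ℝ ↦ u - δ) ⁻¹' D := by
    show (0 : ℝ) - δ ∈ D
    rw [zero_sub]; exact hδD
  have h2max := hmax.comp_add (b - δ)
  have h02 : (0 : ℝ) ∈ {u : ℝ | u + (b - δ) ∈ dom'} := by
    show 0 + (b - δ) ∈ dom'
    rw [zero_add]; exact hbδ
  have hev : (fun u ↦ β (u - δ)) =ᶠ[𝓝 0] fun u ↦ γ (u - (-(b - δ))) := by
    have hn1 : ∀ᶠ u in 𝓝 (0 : ℝ), u - δ ∈ D :=
      (continuous_id.sub continuous_const).continuousAt.preimage_mem_nhds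
        (hDo.mem_nhds (by show (0 : ℝ) - δ ∈ D; rw [zero_sub]; exact hδD))
    have hn2 : ∀ᶠ u in 𝓝 (0 : ℝ), u - δ + b ∈ dom' :=
      ((continuous_id.sub continuous_const).add continuous_const).continuousAt.preimage_mem_nhds
        (hmax.isOpen.mem_nhds (by
          show (0 : ℝ) - δ + b ∈ dom'
          rw [zero_sub, neg_add_eq_sub]; exact hbδ))
    filter_upwards [hn1, hn2] with u hu1 hu2
    have e2 : u - (-(b - δ)) = u - δ + b := by ring
    show β (u - δ) = γ (u - (-(b - δ)))
    rw [e2]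
    exact hβγ _ hu1 hu2
  have hpos : (fun u ↦ β (u - δ)) 0 = (fun u ↦ γ (u - (-(b - δ)))) 0 := hev.eq_of_nhds
  have hvel : velocity I (fun u ↦ β (u - δ)) 0 = velocity I (fun u ↦ γ (u - (-(b - δ)))) 0 :=
    velocity_congr_of_eventuallyEq (I := I) hev
  -- both are restrictions of THE maximal geodesic with these data; the second is all of it
  obtain ⟨Γ, S, hΓmax, -, -, -, hΓr⟩ :=
    exists_isMaximalGeodesicOn (cov := cov) ((fun u ↦ β (u - δ)) 0)
      (velocity I (fun u ↦ β (u - δ)) 0)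
  have h1S : (fun u : ℝ ↦ u - δ) ⁻¹' D ⊆ S := (hΓr _ _ h1open h1oc h01 h1geo rfl rfl).1
  obtain ⟨h2S, h2eq⟩ :=
    hΓr _ _ h2max.isOpen h2max.2.1 h02 h2max.isGeodesicOn hpos.symm hvel.symm
  have hS2 : S = {u : ℝ | u + (b - δ) ∈ dom'} :=
    h2max.2.2.2 Γ S hΓmax.isOpen hΓmax.2.1 h2S hΓmax.isGeodesicOn h2eq
  -- `δ` lies in the first domain, hence `b = δ + (b - δ)` lies in `dom'`
  have hδ1 : δ ∈ (fun u : ℝ ↦ u - δ) ⁻¹' D := by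
    show δ - δ ∈ D
    rw [sub_self]; exact h0D
  have hb' : δ + (b - δ) ∈ dom' := by
    have h := h1S hδ1
    rw [hS2] at h
    exact h
  rw [add_sub_cancel] at hb'
  exact hbnot hb'

end Literature.Geometry.Lorentzian

end
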